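import Mathlib.MeasureTheory.Integral.IntervalIntegral.Basic
import Mathlib.Analysis.SpecialFunctions.Integrals.Basic
import HarnessLib

/-!
# Booker's lemma (Trudgian 2011, Lemma 2.10) — named fact

Trunk T-ANT (`NumberTheory/LFunctions`), family RH.  The elementary-but-computational inequality
behind the constant `log 4` in the lower bound for `∫_{1/2}^∞ log|ζ(σ+it)| dσ` in Turing's method
(Booker 2006, Lemma 4.4 for `d = 1`; Trudgian 2011, Lemma 2.10 for `½ < d ≤ 1`):

  for `w ∈ ℂ` with `|Re w| ≤ ½` and `½ < d ≤ 1`,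
  `∫_0^d log |(x+d+w)(x+d−w̄) / ((x+w)(x−w̄))| dx ≤ d² (log 4) · Re (1/(d+w) + 1/(d−w̄))`,

applied with `w = ½ + it − ρ` to a pair of zeros `ρ, 1 − ρ̄` of `ξ` [Trudgian 2011, after
Lemma 2.10].  Equality holds at `w = 0` for every `d` (`∫_0^d log((x+d)²/x²) dx = 2d log 4`).
Booker's published proof (arXiv:math/0507502, Lemma 6 = Exp. Math. 15 (2006), Lemma 4.4) is a
sketch whose last step is a *numerical verification* on `Re w = ½`, `0 ≤ Im w ≤ 2` (with the
maximum modulus principle on a rectangle and asymptotics for `|Im w| ≥ 2`); Trudgian's extension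
to `½ < d ≤ 1` is asserted to be "straightforward".  No machine-checkable proof being available,
the statement is vendored as a NAMED FACT; users take `(h : Trudgian2011_lemma_2_10)`.  (It was
spot-checked numerically on a grid `d ∈ {0.51,…,1}`, `Re w ∈ [−½, ½]`, `Im w ∈ [0, 50]` when
vendored: no violation, minimum slack at the equality point `w = 0`.)

* `Literature.NumberTheory.LFunctions.Trudgian2011_lemma_2_10` — the displayed statement (named fact);
* `Literature.NumberTheory.LFunctions.Booker2006_lemma_4_4` — the case `d = 1` (named fact), with
  `Trudgian2011_lemma_2_10.booker : Trudgian2011_lemma_2_10 → Booker2006_lemma_4_4`.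

The poles `w = −d`, `w = d` of the right-hand side are excluded by `|Re w| ≤ ½ < d`; zeros of
`(x+w)(x−w̄)` on `[0, d]` (real `w`) are integrable logarithmic singularities (and Lean's
`log 0 = 0` changes the integrand only on a null set).

## References

* A. R. Booker, *Artin's conjecture, Turing's method, and the Riemann hypothesis*, Experiment.
  Math. 15 (2006), 385–407, Lemma 4.4 (arXiv:math/0507502, Lemma 6).  [Booker2006]
* T. S. Trudgian, *Improvements to Turing's method*, Math. Comp. 80 (2011), Lemma 2.10.
  [Trudgian2011]
-/

noncomputable section

open Complex MeasureTheory intervalIntegral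
open scoped ComplexConjugate

namespace Literature.NumberTheory.LFunctions

/-- Booker's integrand `log |(x+d+w)(x+d−w̄)/((x+w)(x−w̄))|`. [cite: Trudgian2011, Lemma 2.10] -/
def bookerIntegrand (d : ℝ) (w : ℂ) (x : ℝ) : ℝ :=
  Real.log ‖((x : ℂ) + d + w) * ((x : ℂ) + d - conj w) / (((x : ℂ) + w) * ((x : ℂ) - conj w))‖

/-- NAMED FACT (**Trudgian 2011, Lemma 2.10**, extending Booker 2006, Lemma 4.4 from `d = 1`):
for `w ∈ ℂ` with `|Re w| ≤ ½` and `½ < d ≤ 1`,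
`∫_0^d log|(x+d+w)(x+d−w̄)/((x+w)(x−w̄))| dx ≤ d² log 4 · Re(1/(d+w) + 1/(d−w̄))`.
Printed proof: Booker's (numerical on `Re w = ½`, `0 ≤ Im w ≤ 2`) for `d = 1`; "the adaptation
to `½ < d ≤ 1` is straightforward" (Trudgian). Users take `(h : Trudgian2011_lemma_2_10)`.
[cite: Trudgian2011, Lemma 2.10] [cite: Booker2006, Lemma 4.4] -/
def Trudgian2011_lemma_2_10 : Prop :=
  ∀ (d : ℝ) (w : ℂ), 1 / 2 < d → d ≤ 1 → |w.re| ≤ 1 / 2 →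
    ∫ x in (0 : ℝ)..d, bookerIntegrand d w x ≤
      d ^ 2 * Real.log 4 * ((1 / ((d : ℂ) + w)).re + (1 / ((d : ℂ) - conj w)).re)

/-- NAMED FACT (**Booker 2006, Lemma 4.4**; arXiv version Lemma 6): for `|Re w| ≤ ½`,
`∫_0^1 log|(x+1+w)(x+1−w̄)/((x+w)(x−w̄))| dx ≤ log 4 · Re(1/(1+w) + 1/(1−w̄))`.
[cite: Booker2006, Lemma 4.4] -/
def Booker2006_lemma_4_4 : Prop :=
  ∀ (w : ℂ), |w.re| ≤ 1 / 2 →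
    ∫ x in (0 : ℝ)..1, bookerIntegrand 1 w x ≤
      Real.log 4 * ((1 / ((1 : ℂ) + w)).re + (1 / ((1 : ℂ) - conj w)).re)

/-- Booker's lemma is the case `d = 1` of Trudgian's. [cite: Trudgian2011, Lemma 2.10] -/
theorem Trudgian2011_lemma_2_10.booker (h : Trudgian2011_lemma_2_10) : Booker2006_lemma_4_4 := by
  intro w hw
  have := h 1 w (by norm_num) le_rfl hw
  simpa using this

/-- Unfolding lemma for the integrand. [folklore] -/
theorem bookerIntegrand_def (d : ℝ) (w : ℂ) (x : ℝ) : bookerIntegrand d w x =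
    Real.log ‖((x : ℂ) + d + w) * ((x : ℂ) + d - conj w) / (((x : ℂ) + w) * ((x : ℂ) - conj w))‖ :=
  rfl

/-- The right-hand side has no pole under the hypotheses: `d + w ≠ 0` and `d − w̄ ≠ 0` when
`|Re w| ≤ ½ < d`. [folklore] -/
theorem booker_rhs_denominators_ne_zero {d : ℝ} {w : ℂ} (hd : 1 / 2 < d) (hw : |w.re| ≤ 1 / 2) :
    (d : ℂ) + w ≠ 0 ∧ (d : ℂ) - conj w ≠ 0 := by
  have h1 := (abs_le.1 hw).1
  have h2 := (abs_le.1 hw).2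
  constructor
  · intro h; have := congrArg Complex.re h; simp at this; linarith
  · intro h; have := congrArg Complex.re h; simp at this; linarith

/-- **The equality case `w = 0`** (for every `d > 0`): `∫_0^d log((x+d)²/x²) dx = 2d log 4
= d² log 4 · Re(1/d + 1/d)` — in particular the named fact is sharp and not vacuous.
[cite: Booker2006, Lemma 4.4 (proof: "equality is attained at w = 0")] -/
theorem booker_equality_case {d : ℝ} (hd : 0 < d) :
    ∫ x in (0 : ℝ)..d, bookerIntegrand d 0 x =
      d ^ 2 * Real.log 4 * ((1 / ((d : ℂ) + 0)).re + (1 / ((d : ℂ) - conj 0)).re) := by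
  -- the integrand is `2 log(x+d) − 2 log x` on `(0, d]`
  have hae : ∀ x ∈ Set.Ioc (0 : ℝ) d,
      bookerIntegrand d 0 x = 2 * Real.log (x + d) - 2 * Real.log x := by
    intro x hx
    have hx0 : 0 < x := hx.1
    simp only [bookerIntegrand, map_zero, add_zero, sub_zero]
    have e1 : ((x : ℂ) + d) * ((x : ℂ) + d) / ((x : ℂ) * (x : ℂ)) =
        ((((x + d) ^ 2 / x ^ 2 : ℝ)) : ℂ) := by
      push_cast; ring
    rw [e1, Complex.norm_real, Real.norm_eq_abs, abs_of_pos (by positivity),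
      Real.log_div (by positivity) (by positivity), Real.log_pow, Real.log_pow]
    push_cast; ring
  have hcongr : ∫ x in (0 : ℝ)..d, bookerIntegrand d 0 x =
      ∫ x in (0 : ℝ)..d, (2 * Real.log (x + d) - 2 * Real.log x) := by
    refine intervalIntegral.integral_congr_ae ?_
    rw [Set.uIoc_of_le hd.le]
    exact Filter.Eventually.of_forall hae
  have hI1 : IntervalIntegrable (fun x ↦ Real.log x) volume 0 d :=
    intervalIntegral.intervalIntegrable_log'
  have hI2 : IntervalIntegrable (fun x ↦ Real.log (x + d)) volume 0 d := by
    have h := (intervalIntegral.intervalIntegrable_log' (a := 0 + d) (b := d + d)).comp_add_right d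
    simpa using h
  rw [hcongr, intervalIntegral.integral_sub (hI2.const_mul 2) (hI1.const_mul 2),
    intervalIntegral.integral_const_mul, intervalIntegral.integral_const_mul,
    intervalIntegral.integral_comp_add_right (fun x ↦ Real.log x), integral_log, integral_log]
  simp only [zero_add, Real.log_zero, mul_zero, sub_zero, map_zero, add_zero, one_div]
  have h4 : Real.log 4 = 2 * Real.log 2 := by
    rw [show (4 : ℝ) = 2 ^ 2 by norm_num, Real.log_pow]; norm_num
  have h2d : Real.log (d + d) = Real.log 2 + Real.log d := by
    rw [← two_mul, Real.log_mul (by norm_num) hd.ne']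
  have hre : ((d : ℂ)⁻¹).re = d⁻¹ := by
    rw [← Complex.ofReal_inv, Complex.ofReal_re]
  rw [h4, h2d, hre]
  field_simp
  ring

end Literature.NumberTheory.LFunctions
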